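import Summits.RiemannHypothesis.RiemannHypothesis.Theorems.IntegerScrewCensusFastCheckB
import Summits.RiemannHypothesis.RiemannHypothesis.Theorems.IntegerScrewCensusUTab

/-!
# Route `IntegerScrew` — the census u-table as SCALED DIGITS for the fast checker

The fast checker (`IntegerScrewCensusFastCheck`) reads the entries `u(a,b) = Ψ(log(a/b)) − C/4` of `S_M` as pairs of
naturals `(SH·δ, SH·(δ+w))` decoded by `unpackRowsNN` from the packed literal `RungCert.utabSP` of `IntegerScrewCensusUTab`
(`SH = 2^116`, digit `δ = lo + 2^55`, width `w = hi − lo`, where `⟨lo, hi⟩ ∋ 2^48·u(a,b)` is the tree's decoding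
`RungCert.utabS = unpackRowsFI …`).  This file defines the table `utabNN`, the validity predicate `UTabOK utab n` the
soundness theorem consumes (row `a` has `a` entries; entry `(a,b)`, `1 ≤ b < a ≤ n+1`, brackets `2^164·u(a,b) + OZ` and is
`< 2^174`), relates the two decoders entry by entry, and proves ★ `utabNN_ok : UTabOK utabNN 112` from `mem_ug_utabS`.
RH-free; nothing here bears on the truth of RH.
-/

set_option linter.dupNamespace false
set_option autoImplicit false

namespace Summit.RiemannHypothesis.RiemannHypothesis.Theorems.IntegerScrew.Manifest.Fast

open Literature.Analysis.ValidatedNumerics Literature.Analysis.ValidatedNumerics.Numerics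

/-- The census u-table as scaled digits: row `a ≥ 1` = `unpackNN 2^56 2^28 utabSP[a−1] a` (row `0` empty). -/
def utabNN : List (List (ℕ × ℕ)) := [] :: unpackRowsNN (2 ^ 56) (2 ^ 28) RungCert.utabSP 1

/-- VALIDITY of a scaled-digit u-table up to node `n + 1`: every row `1 ≤ a ≤ n+1` has `a` entries, and its entry
`1 ≤ b < a` is a pair `(p₁, p₂)` with `p₁ ≤ 2^164·u(a,b) + OZ ≤ p₂ < 2^174`. -/
def UTabOK (utab : List (List (ℕ × ℕ))) (n : ℕ) : Prop :=
  ∀ a, 1 ≤ a → a ≤ n + 1 → (utab.getD a []).length = a ∧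
    ∀ b, 1 ≤ b → b < a →
      (((utab.getD a []).getD b (0, 0)).1 : ℝ) ≤ 2 ^ 164 * RungCert.uR a b + OZ ∧
      2 ^ 164 * RungCert.uR a b + OZ ≤ (((utab.getD a []).getD b (0, 0)).2 : ℝ) ∧
      ((utab.getD a []).getD b (0, 0)).2 < 2 ^ 174

/-! ### The two decoders, entry by entry -/

/-- Length of a decoded row. -/
theorem length_unpackNN (B W : ℕ) : ∀ (m k : ℕ), (unpackNN B W m k).length = k
  | _, 0 => rfl
  | m, k + 1 => by rw [unpackNN_succ, List.length_cons, length_unpackNN B W _ k]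

/-- Unfolding of the tree's `unpackFI`. -/
theorem unpackFI_succ (B O W m k : ℕ) :
    RungCert.unpackFI B O W m (k + 1) =
      ⟨((m % B : ℕ) : ℤ) - O, ((m % B : ℕ) : ℤ) - O + ((m / B % W : ℕ) : ℤ)⟩ :: RungCert.unpackFI B O W (m / B / W) k := rfl

/-- **Entry `j` of the scaled digits vs entry `j` of the tree's intervals**: `(SH·(lo + O), SH·(hi + O))`, and the
size bound `< SH·(B + W)` of the upper digit. -/
theorem unpackNN_getD (B O W : ℕ) (hB : 0 < B) (hW : 0 < W) : ∀ (k m j : ℕ), j < k →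
    ((((unpackNN B W m k).getD j (0, 0)).1 : ℕ) : ℤ) = SH * (((RungCert.unpackFI B O W m k).getD j (FI.ofInt 0)).lo + O) ∧
    ((((unpackNN B W m k).getD j (0, 0)).2 : ℕ) : ℤ) = SH * (((RungCert.unpackFI B O W m k).getD j (FI.ofInt 0)).hi + O) ∧
    ((unpackNN B W m k).getD j (0, 0)).2 < SH * (B + W)
  | 0, _, _, h => absurd h (Nat.not_lt_zero _)
  | k + 1, m, 0, _ => by
    rw [unpackNN_succ, unpackFI_succ, List.getD_cons_zero, List.getD_cons_zero]
    refine ⟨?_, ?_, ?_⟩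
    · push_cast; ring
    · push_cast; ring
    · exact Nat.mul_lt_mul_of_pos_left (Nat.add_lt_add (Nat.mod_lt _ hB) (Nat.mod_lt _ hW)) (by norm_num [SH])
  | k + 1, m, j + 1, h => by
    rw [unpackNN_succ, unpackFI_succ, List.getD_cons_succ, List.getD_cons_succ]
    exact unpackNN_getD B O W hB hW k (m / B / W) j (by omega)

/-- Rows of `unpackRowsNN`. -/
theorem getD_unpackRowsNN (B W : ℕ) : ∀ (ms : List ℕ) (a0 r : ℕ), r < ms.length →
    (unpackRowsNN B W ms a0).getD r [] = unpackNN B W (ms.getD r 0) (a0 + r)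
  | [], _, _, h => by simp at h
  | m :: ms, a0, 0, _ => by simp [unpackRowsNN]
  | m :: ms, a0, r + 1, h => by
    simp only [unpackRowsNN, List.getD_cons_succ]
    rw [getD_unpackRowsNN B W ms (a0 + 1) r (by simpa using h)]
    congr 1
    omega

/-- Rows of the tree's `unpackRowsFI`. -/
theorem getD_unpackRowsFI (B O W : ℕ) : ∀ (ms : List ℕ) (a0 r : ℕ), r < ms.length →
    (RungCert.unpackRowsFI B O W ms a0).getD r [] = RungCert.unpackFI B O W (ms.getD r 0) (a0 + r)
  | [], _, _, h => by simp at h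
  | m :: ms, a0, 0, _ => by simp [RungCert.unpackRowsFI]
  | m :: ms, a0, r + 1, h => by
    simp only [RungCert.unpackRowsFI, List.getD_cons_succ]
    rw [getD_unpackRowsFI B O W ms (a0 + 1) r (by simpa using h)]
    congr 1
    omega

/-- The packed literal has `113` rows. -/
theorem length_utabSP : RungCert.utabSP.length = 113 := by decide

/-- Row `a` of `utabNN`, `1 ≤ a ≤ 113`. -/
theorem utabNN_row {a : ℕ} (h1 : 1 ≤ a) (h2 : a ≤ 113) :
    utabNN.getD a [] = unpackNN (2 ^ 56) (2 ^ 28) (RungCert.utabSP.getD (a - 1) 0) a := by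
  obtain ⟨r, rfl⟩ : ∃ r, a = r + 1 := ⟨a - 1, by omega⟩
  unfold utabNN
  rw [List.getD_cons_succ, getD_unpackRowsNN _ _ _ _ _ (by rw [length_utabSP]; omega)]
  simp [Nat.add_comm]

/-- Row `a` of the tree's `utabS`, `1 ≤ a ≤ 113`. -/
theorem utabS_row {a : ℕ} (h1 : 1 ≤ a) (h2 : a ≤ 113) :
    RungCert.utabS.getD a [] = RungCert.unpackFI (2 ^ 56) (2 ^ 55) (2 ^ 28) (RungCert.utabSP.getD (a - 1) 0) a := by
  obtain ⟨r, rfl⟩ : ∃ r, a = r + 1 := ⟨a - 1, by omega⟩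
  unfold RungCert.utabS
  rw [List.getD_cons_succ, getD_unpackRowsFI _ _ _ _ _ _ (by rw [length_utabSP]; omega)]
  simp [Nat.add_comm]

/-- **The census u-table is valid up to node `113`** (`n + 1 ≤ 113`). -/
theorem utabNN_ok {n : ℕ} (hn : n + 1 ≤ 113) : UTabOK utabNN n := by
  intro a ha1 ha
  have ha113 : a ≤ 113 := ha.trans hn
  rw [utabNN_row ha1 ha113]
  refine ⟨length_unpackNN _ _ _ _, fun b hb1 hba => ?_⟩
  obtain ⟨h1, h2, h3⟩ := unpackNN_getD (2 ^ 56) (2 ^ 55) (2 ^ 28) (by norm_num) (by norm_num) a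
    (RungCert.utabSP.getD (a - 1) 0) b hba
  have hmem := RungCert.mem_ug_utabS hb1 hba ha113
  unfold RungCert.ug at hmem
  rw [utabS_row ha1 ha113] at hmem
  set I := (RungCert.unpackFI (2 ^ 56) (2 ^ 55) (2 ^ 28) (RungCert.utabSP.getD (a - 1) 0) a).getD b (FI.ofInt 0)
  set p := (unpackNN (2 ^ 56) (2 ^ 28) (RungCert.utabSP.getD (a - 1) 0) a).getD b (0, 0)
  obtain ⟨hlo, hhi⟩ := hmem
  have hSC : (SC : ℝ) = 2 ^ 48 := by norm_num [SC]
  have hSH : (SH : ℝ) = 2 ^ 116 := by norm_num [SH]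
  have hOZ : (OZ : ℝ) = 2 ^ 171 := by norm_num [OZ]
  rw [hSC] at hlo hhi
  have e1 : ((p.1 : ℕ) : ℝ) = SH * ((I.lo : ℝ) + 2 ^ 55) := by exact_mod_cast h1
  have e2 : ((p.2 : ℕ) : ℝ) = SH * ((I.hi : ℝ) + 2 ^ 55) := by exact_mod_cast h2
  refine ⟨?_, ?_, ?_⟩
  · rw [e1, hSH, hOZ]; nlinarith
  · rw [e2, hSH, hOZ]; nlinarith
  · exact h3.trans_le (by norm_num [SH])

end Summit.RiemannHypothesis.RiemannHypothesis.Theorems.IntegerScrew.Manifest.Fast
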